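import Mathlib

/-!
# FoolingMeasure (stmt-PneNP-19727) — crux-ideate round 2, seat 2, g10: typed first lemmas

Three objects used by the idea cards `height-transport-criticality`, `twist-rank`,
`top-of-frame-halves`.  Everything is over `Finset (Sym2 (Fin n))` edge sets, as in the route file
`Summits/PneNP/PneNP/Theses/AeaCutRectangles.lean`.  Statements only (no proofs claimed here).
-/

set_option linter.dupNamespace false
set_option autoImplicit false

namespace Summit.PneNP.PneNP.Cruxes.FoolingMeasure.R2s2g10

open Finset

variable {n : ℕ}

/-- the graph of an edge set -/
abbrev gr (S : Finset (Sym2 (Fin n))) : SimpleGraph (Fin n) :=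
  SimpleGraph.fromEdgeSet (S : Set (Sym2 (Fin n)))

/-- 4-edge-criticality for 3 colours: not 3-colourable, but every single-edge deletion is. -/
def EdgeCritical (S : Finset (Sym2 (Fin n))) : Prop :=
  ¬ (gr S).Colorable 3 ∧ ∀ e ∈ S, (gr (S.erase e)).Colorable 3

/-! ## 1. Height frames (card `height-transport-criticality`)

A HEIGHT FRAME for `S` is an integer height `Λ` and a defect edge `d = s(a,b)` such that every other
edge has height difference `1` (a UNIT edge) or a difference `≥ 2` that is `≡ 2 (mod 3)` (a LONG edge),
unit edges occupy distinct levels, and the defect joins the bottom to a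
`≡ 0 (mod 3)` higher level.  Normal cycle systems (card `normal-cycle-systems`) are the special case
`Λ = position along a Hamiltonian ruler`; non-injective heights and short rulers are allowed here. -/
structure HeightFrame (S : Finset (Sym2 (Fin n))) where
  Λ : Fin n → ℤ
  a : Fin n
  b : Fin n
  defect_mem : s(a, b) ∈ S
  defect_mod : (Λ b - Λ a) % 3 = 0
  bot_lt_top : Λ a < Λ b
  /-- every non-defect edge is a unit edge or a long edge with difference ≡ 2 (mod 3) -/
  rule : ∀ x y, s(x, y) ∈ S → s(x, y) ≠ s(a, b) →
    |Λ x - Λ y| = 1 ∨ (2 ≤ |Λ x - Λ y| ∧ |Λ x - Λ y| % 3 = 2)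
  /-- unit edges sit on distinct levels -/
  unit_levels : ∀ x y x' y', s(x, y) ∈ S → s(x', y') ∈ S →
    Λ y = Λ x + 1 → Λ y' = Λ x' + 1 → Λ x = Λ x' → s(x, y) = s(x', y')

/-- The edges CERTIFIED by a height frame: its defect, and its unit edges between bottom and top. -/
def HeightFrame.certifies {S : Finset (Sym2 (Fin n))} (F : HeightFrame S) (e : Sym2 (Fin n)) : Prop :=
  e = s(F.a, F.b) ∨ ∃ x y, e = s(x, y) ∧ F.Λ y = F.Λ x + 1 ∧ F.Λ F.a ≤ F.Λ x ∧ F.Λ x < F.Λ F.b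

/-- FIRST LEMMA (height twist).  An edge certified by a height frame is critical: deleting it leaves a
3-colourable edge set (colour `v ↦ Λ v + [Λ v ≤ Λ x] mod 3` for the unit edge `s(x,y)`, `Λ mod 3` for
the defect).  Elementary; the general form of `Theorems/...NormalCycleSystems` criticality-for-free. -/
def HeightTwist : Prop :=
  ∀ (n : ℕ) (S : Finset (Sym2 (Fin n))) (F : HeightFrame S) (e : Sym2 (Fin n)),
    e ∈ S → F.certifies e → (gr (S.erase e)).Colorable 3

/-- A HEIGHT SYSTEM: finitely many height frames certifying every edge.  With `HeightTwist`,
a non-3-colourable height system is 4-edge-critical (`heightSystem_critical`). -/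
def IsHeightSystem (S : Finset (Sym2 (Fin n))) (t : ℕ) : Prop :=
  ∃ F : Fin t → HeightFrame S, ∀ e ∈ S, ∃ k, (F k).certifies e

def HeightSystemCritical : Prop :=
  ∀ (n t : ℕ) (S : Finset (Sym2 (Fin n))), IsHeightSystem S t → ¬ (gr S).Colorable 3 → EdgeCritical S

/-- ISOLATION (local maximality) of height systems under 2-switches: if `S' = S - ab - cd + ac + bd`
is NOT 3-colourable and `ab` is a unit edge certified by frame `F`, then one of the new edges violates
`F.rule` (it is monochromatic or uphill-by-`≡1` for `Λ`).  Proof idea: otherwise the twisted frame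
colouring of `S - ab` is proper on `S'`.  This is the exact mechanism behind the E1 swap census. -/
def SwitchIsolation : Prop :=
  ∀ (n : ℕ) (S : Finset (Sym2 (Fin n))) (F : HeightFrame S) (a b c d : Fin n),
    s(a, b) ∈ S → s(c, d) ∈ S → s(a, c) ∉ S → s(b, d) ∉ S →
    F.Λ b = F.Λ a + 1 → F.Λ F.a ≤ F.Λ a → F.Λ a < F.Λ F.b →
    ¬ (gr (((S.erase s(a, b)).erase s(c, d)) ∪ {s(a, c), s(b, d)})).Colorable 3 →
      (|F.Λ a - F.Λ c| % 3 = 0 ∨ |F.Λ a - F.Λ c| % 3 = 1) ∨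
      (|F.Λ b - F.Λ d| % 3 = 0 ∨ |F.Λ b - F.Λ d| % 3 = 1)

/-! ## 2. Winding classes and twist rank (card `twist-rank`)

Relative to a reference near-colouring `h` (proper off its defect `d`), a colouring `c` is ZERO-WINDING
when the phase `c - h` lifts to an integer potential with steps in `{0,1}` along every `h`-arc
(`h y = h x + 1`); this is the Cereceda–van den Heuvel–Johnson cycle-weight invariant
(doi:10.1002/jgt.20514, §2) in relative form, and the `zero-winding layer` of card
`sparse-greenwell-lovasz`.  The TWIST RANK of a 4-critical `S` is the least number of reference
near-colourings such that every edge has a zero-winding certificate relative to one of them. -/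
def ZeroWinding (S : Finset (Sym2 (Fin n))) (d : Sym2 (Fin n)) (h c : Fin n → ZMod 3) : Prop :=
  ∃ Q : Fin n → ℤ, (∀ v, ((Q v : ℤ) : ZMod 3) = c v - h v) ∧
    ∀ x y, s(x, y) ∈ S → s(x, y) ≠ d → h y = h x + 1 → (Q y = Q x ∨ Q y = Q x + 1)

/-- proper 3-colouring of an edge set, as a `ZMod 3`-valued function -/
def ProperOn (S : Finset (Sym2 (Fin n))) (c : Fin n → ZMod 3) : Prop :=
  ∀ x y, s(x, y) ∈ S → x ≠ y → c x ≠ c y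

/-- `TwistRankLE S s`: `s` reference near-colourings (each proper off one defect edge of `S`) such that
every edge `e` of `S` has a proper colouring of `S - e` that is zero-winding for one of them. -/
def TwistRankLE (S : Finset (Sym2 (Fin n))) (s : ℕ) : Prop :=
  ∃ (d : Fin s → Sym2 (Fin n)) (h : Fin s → Fin n → ZMod 3),
    (∀ i, d i ∈ S ∧ ProperOn (S.erase (d i)) (h i)) ∧
    ∀ e ∈ S, ∃ i, ∃ c : Fin n → ZMod 3, ProperOn (S.erase e) c ∧ ZeroWinding S (d i) (h i) c

/-- Easy direction (first lemma of the card): a height system with `t` frames has twist rank `≤ t`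
(the twisted frame colourings are zero-winding relative to their frame). -/
def HeightSystem_twistRank_le : Prop :=
  ∀ (n t : ℕ) (S : Finset (Sym2 (Fin n))), IsHeightSystem S t → ¬ (gr S).Colorable 3 → TwistRankLE S t

/-- The card's NECESSARY-CONDITION conjecture (kill side, typed): supports of uniformly bounded twist
rank cannot fool.  `FewFrames s` restricts X1's construction space to supports with `TwistRankLE S s`
for a FIXED `s`; the conjecture is its negation for every `s` (align-all-frames costs `s·|B|·log₂3 =
O(n)` bits, below the `(n/2)·log₂ n` budget; darkness of the aligned class is the portal-forcing step of
`Theorems/AeaCutRectanglesTransversalEngine`). -/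
def FoolingMeasureFewFrames (s : ℕ) : Prop :=
  ∃ ε : ℝ, 0 < ε ∧ ε ≤ 1 / 4 ∧ ∀ C : ℕ, ∃ᶠ n in Filter.atTop, ∃ μ : Finset (Sym2 (Fin n)) → ℝ,
    (∀ S, 0 ≤ μ S) ∧ (∑ S, μ S = 1) ∧
    (∀ S, μ S ≠ 0 → (∀ e ∈ S, ¬ e.IsDiag) ∧ ¬ (gr S).Colorable 3 ∧ TwistRankLE S s) ∧
    ∀ B : Finset (Fin n), (1 / 2 - ε) * (n : ℝ) ≤ B.card → (B.card : ℝ) ≤ (1 / 2 + ε) * n →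
      ∀ 𝓐 𝓑 : Finset (Finset (Sym2 (Fin n))),
        (∀ α ∈ 𝓐, ∀ e ∈ α, ¬ e.IsDiag ∧ ∃ v ∈ e, v ∉ B) →
        (∀ β ∈ 𝓑, ∀ e ∈ β, ¬ e.IsDiag ∧ ∀ v ∈ e, v ∈ B) →
        (∀ α ∈ 𝓐, ∀ β ∈ 𝓑, ¬ (gr (α ∪ β)).Colorable 3) →
        ∑ q ∈ 𝓐 ×ˢ 𝓑, μ (q.1 ∪ q.2) ≤ (2 : ℝ) ^ (-((n : ℝ) / 2 * Real.logb 2 n) - (C : ℝ) * n)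

def FewFramesCannotFool : Prop := ∀ s : ℕ, ¬ FoolingMeasureFewFrames s

/-! ## 3. Top-of-frame halves (card `top-of-frame-halves`): the sparse half of a height frame.

For a height frame with colour classes `V_r = {Λ ≡ r}`, the vertex set
`B = V_0 ∪ {v ∈ V_1 : Λ v above the median of V_1}` spans only the unit edges into its `V_1`-part and
the long edges going UP from it; for a circulant normal system with ruler step `s_k` this is
`n/6 + (n/3)·Σ_{j≠k} |r_{kj} - 1/2| + O(t)` edges, `r_{kj} = (s_j s_k⁻¹ mod n)/n`.  X1 needs `> n/2`
inside EVERY near half (Stirling-sharp `foolingMeasure_false_for_sparseHalf`), so `t ≥ 4` and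
`Σ_{j≠k}|r_{kj} - 1/2| > 1` for every `k` are necessary.  Typed here as the elementary count behind it. -/
def topHalf (Λ : Fin n → ℤ) (m : ℤ) : Finset (Fin n) :=
  univ.filter fun v => Λ v % 3 = 0 ∨ (Λ v % 3 = 1 ∧ m < Λ v)

/-- inside-edge count of a vertex set -/
def insideEdges (S : Finset (Sym2 (Fin n))) (B : Finset (Fin n)) : Finset (Sym2 (Fin n)) :=
  S.filter fun e => ∀ v ∈ e, v ∈ B

/-- COUNT LEMMA: inside `topHalf Λ m` a height frame spans only (i) the defect (possibly), (ii) unit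
edges `s(x,y)` going up from `V_0` into the top of `V_1` (`Λ x ≡ 0`, `Λ y = Λ x + 1 > m`), and (iii) long
edges going UP out of the top of `V_1` into `V_0` (`Λ x ≡ 1`, `m < Λ x`, `Λ y ≡ 0`, `Λ y ≥ Λ x + 2`). -/
def TopHalfCount : Prop :=
  ∀ (n : ℕ) (S : Finset (Sym2 (Fin n))) (F : HeightFrame S) (m : ℤ),
    ∀ e ∈ insideEdges S (topHalf F.Λ m), e ≠ s(F.a, F.b) →
      ∃ x y, e = s(x, y) ∧ F.Λ x < F.Λ y ∧
        ((F.Λ x % 3 = 0 ∧ F.Λ y = F.Λ x + 1 ∧ m < F.Λ y) ∨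
         (F.Λ x % 3 = 1 ∧ m < F.Λ x ∧ F.Λ y % 3 = 0 ∧ F.Λ x + 2 ≤ F.Λ y))

end Summit.PneNP.PneNP.Cruxes.FoolingMeasure.R2s2g10
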